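import Literature.Computability.AlgebraicComplexity.PrattTrapezoidValDecomp
import Literature.Computability.AlgebraicComplexity.PrattTrapezoidValSliceRank
import HarnessLib

/-!
# Pratt 2024, Theorem 4.7 — PROVED (`pratt2024_thm47_holds`)

K. Pratt, *On generalized corners and matrix multiplication*, ITCS 2024 = arXiv:2309.03878
[Pratt2024], Thm. 4.7 with its proof (p. 10 of the held text): "If Conjecture 2.5 [the
two-families conjecture of Cohn–Kleinberg–Szegedy–Umans 2005] is true, then for any `ε > 0`,
`Val(ℤₙ) ≥ O(n^{4/3-ε})`."  This file discharges the named fact `pratt2024_thm47` of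
`PrattTrapezoidVal.lean` (statement unchanged: the conjecture, inlined, implies that for every
`ε > 0` and `N₀` there is `N ≥ N₀` with `N^{4/3-ε} ≤ Val(ℤ/Nℤ)`).

## The proof, as printed and as formalised

1. "Let `S ⊂ Δₙ` be corner-free and of size `n^{2-o(1)}`" — `exists_cornerFree_indexMaps_card_ge`
   (`PrattTrapezoidValSDPP.lean`; Behrend via Mathlib's `Behrend.roth_lower_bound`).
2. "define … `A_v = A_{v₁} × {1} × B_{v₃}`, `B_v = B_{v₁} × A_{v₂} × {1}`,
   `C_v = {1} × B_{v₂} × A_{v₃}` … the sets `(A_v, B_v, C_v)_{v ∈ S}` satisfy the STPP" —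
   `addSimultaneousTPP_of_sdpp` (same file).  We apply it to the sub-family of pairs `(Aᵢ, Bᵢ)`
   with `|Aᵢ|, |Bᵢ| ≤ 4|H|/n` (at least half of them: `exists_balanced_indices`,
   `PrattTrapezoidValDecomp.lean`), on which step 5 is efficient; the print is silent here.
3. "the map from `G³ = ℤ_{m₁} × ⋯ × ℤ_{m_k}` to `ℤ_{∏ 3mᵢ}` … the image of sets satisfying the
   STPP under this map still satisfy the STPP.  This shows that `Val(G') > n^{8-o(1)}`" (with
   Prop. 3.3) — `sum_card_mul_le_prattVal_zmod_of_addEquiv` (`PrattTrapezoidValSTPP.lean`),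
   here with `N = (3^k |H|)^3`, `k` = number of cyclic factors of `H` of prime-power order
   (`exists_pi_zmod_decomp`).
4. "the number of `mᵢ`'s which are greater than `ℓ` is trivially less than `log_ℓ |G³|`" —
   `L^{k_L} ≤ |H|` in `exists_pi_zmod_decomp`.
5. "`G³` cannot contain a subgroup of size `|G³|^c` generated by elements of order at most `ℓ` by
   [BCCGNSU 2017].  Hence the number of `mᵢ`'s which are at most `ℓ` is at most `log₂(|G³|^c)`"
   — for each prime power `q ≤ L` occurring `r_q` times, `sum_card_div_le_of_addEquiv_piZMod`
   (`PrattTrapezoidValSliceRank.lean`: BCCGNSU Thm. 3.3 + Lemma 3.4 + Thm. 4.14 with the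
   low-weight estimate `exists_theta`, all proved in the tree) applied to the STPP family of
   step 2 in `H³ ≃ (ℤ/q)^{3r_q} × G'` gives `θ_q^{-3r_q} ≤ 12288 · n^{9δ}`, i.e.
   `r_q = O(δ log n)`.
6. "By taking `c` sufficiently small and `ℓ` sufficiently large, this is at most `n^{6+δ}` …
   The claimed bound follows" — the parameter choice in `pratt2024_thm47_aux`: with
   `ε' = min(ε,1)`, `log L ≥ 12 log 3/ε'`, `Λ = min_{q ≤ L} log(1/θ_q)`,
   `δ = ε'/(12 L log 3/Λ + 8)` (the conjecture is invoked with this `δ`), and `n` large, one gets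
   `(4/3 - ε') log N ≤ log(|S| n^{6-3δ}) ≤ log Val(ℤ/Nℤ)`.

## References

* [Pratt2024] K. Pratt, arXiv:2309.03878: Conj. 2.5, Def. 2.4 (p. 5), Def. 3.2, Prop. 3.3
  (p. 7), Thm. 4.7 and its proof (p. 10).
* [CohnKleinbergSzegedyUmans2005] FOCS 2005, Conj. 4.7 (two families), §6 (SDPP → STPP).
* [BlasiakChurchCohnGrochowNaslundSawinUmans2017] Discrete Analysis 2017:3, Thm. 3.3,
  Lemma 3.4, Thm. 4.14, Prop. 4.12 (tree: `Literature/Combinatorics/Additive/…`).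
-/

namespace Literature.Computability.AlgebraicComplexity

open Finset Literature.Combinatorics.Additive

/-! ### Theorem 4.7 -/

section Thm47

/-- **Pratt 2024, Theorem 4.7, quantitative core**: the two-families hypothesis (as inlined in
`pratt2024_thm47`) gives, for every `0 < ε ≤ 1` and every `N₀`, a modulus `N ≥ N₀` with
`N^{4/3-ε} ≤ Val(ℤ/Nℤ)`.  The printed proof (p. 10), made effective: Behrend corner-free set,
CKSU STPP family in `H³` (on a balanced sub-family of the pairs), Prop. 3.3 after the
mixed-radix transfer to `ℤ_N` with `N = (3^k |H|)^3`, and the count of cyclic factors `k` via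
the slice-rank bound (BCCGNSU) on each homocyclic component of order `≤ L`.
[cite: Pratt2024, Thm. 4.7] -/
theorem pratt2024_thm47_aux
    (hTF : ∀ δ : ℝ, 0 < δ → ∀ n₀ : ℕ, ∃ n ≥ n₀, ∃ (H : Type) (_ : AddCommGroup H) (_ : Fintype H)
      (A B : Fin n → Finset H),
      (∀ i : Fin n, ∀ a ∈ A i, ∀ a' ∈ A i, ∀ b ∈ B i, ∀ b' ∈ B i,
          (a - a') + (b - b') = 0 → a = a' ∧ b = b') ∧
      (∀ i j k : Fin n, ∀ a ∈ A i, ∀ a' ∈ A j, ∀ b ∈ B j, ∀ b' ∈ B k,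
          (a - a') + (b - b') = 0 → i = k) ∧
      (Fintype.card H : ℝ) ≤ (n : ℝ) ^ (2 + δ) ∧
      ∀ i : Fin n, (n : ℝ) ^ (2 - δ) ≤ (((A i).card * (B i).card : ℕ) : ℝ))
    (ε : ℝ) (hε : 0 < ε) (hε1 : ε ≤ 1) (N₀ : ℕ) :
    ∃ N : ℕ, ∃ _ : NeZero N, N₀ ≤ N ∧ (N : ℝ) ^ (4 / 3 - ε) ≤ (prattVal (ZMod N) : ℝ) := by
  classical
  /- ### constants -/
  set c3 : ℝ := Real.log 3 with hc3
  have hc3pos : 0 < c3 := Real.log_pos (by norm_num)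
  set L : ℕ := ⌈Real.exp (12 * c3 / ε)⌉₊ + 2 with hL
  have hL2 : 2 ≤ L := by omega
  have hLpos : (0 : ℝ) < L := by exact_mod_cast (show 0 < L by omega)
  have hlogL : 12 * c3 / ε ≤ Real.log L := by
    have h1 : Real.exp (12 * c3 / ε) ≤ L := by
      have h2 := Nat.le_ceil (Real.exp (12 * c3 / ε))
      have h3 : (⌈Real.exp (12 * c3 / ε)⌉₊ : ℝ) ≤ L := by rw [hL]; push_cast; linarith
      linarith
    have h4 := Real.log_le_log (Real.exp_pos _) h1
    rwa [Real.log_exp] at h4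
  have hlogLpos : 0 < Real.log L := lt_of_lt_of_le (by positivity) hlogL
  choose θ hθpos hθ using Literature.Combinatorics.Additive.exists_theta
  have hne : (Icc 2 L).Nonempty := ⟨2, mem_Icc.2 ⟨le_rfl, hL2⟩⟩
  set Λ : ℝ := (Icc 2 L).inf' hne fun q => -Real.log (θ q) with hΛ
  have hΛpos : 0 < Λ := by
    rw [hΛ, Finset.lt_inf'_iff]
    intro q hq
    have hq2 : 2 ≤ q := (mem_Icc.1 hq).1
    have := Real.log_neg (hθpos q) ((hθ q hq2).1)
    linarith
  have hΛle : ∀ q ∈ Icc 2 L, Λ ≤ -Real.log (θ q) := fun q hq =>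
    Finset.inf'_le (fun q => -Real.log (θ q)) hq
  set c₀ : ℝ := Real.log 3 + 2 * Real.log 4 + 2 * Real.log 2 + Real.log 64 with hc₀
  have hlog2 : 0 ≤ Real.log 2 := Real.log_nonneg (by norm_num)
  have hlog4 : 0 ≤ Real.log 4 := Real.log_nonneg (by norm_num)
  have hlog64 : 0 ≤ Real.log 64 := Real.log_nonneg (by norm_num)
  have hc₀nn : 0 ≤ c₀ := by rw [hc₀]; linarith
  set M : ℝ := 12 * L * c3 / Λ with hM
  have hMnn : 0 ≤ M := by positivity
  set δ : ℝ := ε / (M + 8) with hδ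
  have hδpos : 0 < δ := by positivity
  have hδM : δ * (M + 8) = ε := by rw [hδ]; field_simp
  have hδle : δ ≤ ε / 8 := by
    rw [hδ]
    exact div_le_div_of_nonneg_left hε.le (by norm_num) (by linarith)
  have hδ1 : δ ≤ 1 := by linarith
  set C : ℝ := 4 / 3 * L * c3 * c₀ / Λ + 2 * Real.log 2 + Real.log 64 with hC
  have hCnn : 0 ≤ C := by positivity
  obtain ⟨n₁, hn₁⟩ := exists_cornerFree_indexMaps_card_ge δ hδpos hδ1
  set n₂ : ℕ := ⌈Real.exp (C / ε)⌉₊ with hn₂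
  /- ### the SDPP configuration -/
  obtain ⟨n, hn, H, _i1, _i2, A, B, hD, hSD, hcardH, hAB⟩ := hTF δ hδpos (2 * n₁ + N₀ + n₂ + 16)
  have hnpos : (0 : ℝ) < n := by exact_mod_cast (show 0 < n by omega)
  have hn1 : (1 : ℝ) < n := by exact_mod_cast (show 1 < n by omega)
  set ℓn := Real.log n with hℓn
  have hℓnpos : 0 < ℓn := Real.log_pos hn1
  have hCn : C ≤ ε * ℓn := by
    have h1 : Real.exp (C / ε) ≤ n := by
      have h2 := Nat.le_ceil (Real.exp (C / ε))
      have h3 : (⌈Real.exp (C / ε)⌉₊ : ℝ) ≤ n := by exact_mod_cast (show n₂ ≤ n by omega)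
      linarith
    have h4 := Real.log_le_log (Real.exp_pos _) h1
    rw [Real.log_exp, div_le_iff₀ hε] at h4
    linarith
  -- `Y = n^{2-δ}`
  set Y : ℝ := (n : ℝ) ^ (2 - δ) with hY
  have hYpos : 0 < Y := Real.rpow_pos_of_pos hnpos _
  have hlogY : Real.log Y = 2 * ℓn - δ * ℓn := by rw [hY, Real.log_rpow hnpos]; ring
  have hAB' : ∀ i, Y ≤ ((#(A i) * #(B i) : ℕ) : ℝ) := hAB
  have hABpos : ∀ i, 0 < #(A i) * #(B i) := fun i => by
    have h := hYpos.trans_le (hAB' i)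
    exact_mod_cast h
  have hAne : ∀ i, (A i).Nonempty := fun i => card_pos.1 (Nat.pos_of_mul_pos_right (hABpos i))
  have hBne : ∀ i, (B i).Nonempty := fun i => card_pos.1 (Nat.pos_of_mul_pos_left (hABpos i))
  -- `|H|`
  have hHpos : (0 : ℝ) < Fintype.card H := by exact_mod_cast Fintype.card_pos
  set logH := Real.log (Fintype.card H) with hlogH
  have hlogH_le : logH ≤ 2 * ℓn + δ * ℓn := by
    have h := Real.log_le_log hHpos hcardH
    rw [Real.log_rpow hnpos] at h
    linarith
  have i0 : Fin n := ⟨0, by omega⟩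
  have hHge : Y ≤ Fintype.card H := by
    refine (hAB' i0).trans ?_
    have h : #(A i0) * #(B i0) ≤ Fintype.card H := by
      rw [← card_product]
      have hinj : Set.InjOn (fun p : H × H => p.1 + p.2) ↑(A i0 ×ˢ B i0) := by
        rintro ⟨a, b⟩ hab ⟨a', b'⟩ hab' (h : a + b = a' + b')
        simp only [coe_product, Set.mem_prod, mem_coe] at hab hab'
        have h' : (a - a') + (b - b') = 0 := by
          have e1 : (a - a') + (b - b') = (a + b) - (a' + b') := by abel
          rw [e1, h, sub_self]
        obtain ⟨rfl, rfl⟩ := hD i0 a hab.1 a' hab'.1 b hab.2 b' hab'.2 h'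
        rfl
      calc #(A i0 ×ˢ B i0) = #((A i0 ×ˢ B i0).image fun p : H × H => p.1 + p.2) :=
            (card_image_of_injOn hinj).symm
        _ ≤ Fintype.card H := card_le_univ _
    exact_mod_cast h
  have hlogH_ge : 2 * ℓn - δ * ℓn ≤ logH := by
    have h := Real.log_le_log hYpos hHge
    rwa [hlogY] at h
  have hδℓ : δ * ℓn ≤ ℓn := mul_le_of_le_one_left hℓnpos.le hδ1
  /- ### balanced sub-family -/
  obtain ⟨good, hgood2, hgood⟩ := exists_balanced_indices (S := Fintype.card H)
    (fun i => #(A i)) (fun i => #(B i)) (sum_card_le_card_of_sdpp_left hSD hBne)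
    (sum_card_le_card_of_sdpp_right hSD hAne)
  set n' := #good with hn'
  set g : Fin n' ↪o Fin n := good.orderEmbOfFin rfl with hg
  have hgmem : ∀ y, g y ∈ good := fun y => Finset.orderEmbOfFin_mem good rfl y
  have hn'ge : n₁ ≤ n' := by omega
  have hn'pos : (0 : ℝ) < n' := by exact_mod_cast (show 0 < n' by omega)
  /- ### corner-free indices and the STPP family in `H³` -/
  obtain ⟨ι₀, _, _, j₁, j₂, j₃, hι₀, hcf⟩ := hn₁ n' hn'ge
  set i₁ : ι₀ → Fin n := fun x => g (j₁ x) with hi₁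
  set i₂ : ι₀ → Fin n := fun x => g (j₂ x) with hi₂
  set i₃ : ι₀ → Fin n := fun x => g (j₃ x) with hi₃
  have hcf' : ∀ x y z : ι₀, i₁ x = i₁ z → i₂ y = i₂ x → i₃ z = i₃ y → x = y ∧ y = z :=
    fun x y z h1 h2 h3 => hcf x y z (g.injective h1) (g.injective h2) (g.injective h3)
  have hS := addSimultaneousTPP_of_sdpp hD hSD i₁ i₂ i₃ hcf'
  have hι₀pos : 0 < Fintype.card ι₀ := by
    by_contra h0
    push Not at h0
    have h0' : Fintype.card ι₀ = 0 := by omega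
    rw [h0', Nat.cast_zero, mul_zero] at hι₀
    exact absurd hι₀ (not_le.2 (Real.rpow_pos_of_pos hn'pos _))
  have hι₀posR : (0 : ℝ) < Fintype.card ι₀ := by exact_mod_cast hι₀pos
  set logι := Real.log (Fintype.card ι₀) with hlogιdef
  have hlogι : 2 * ℓn - δ * ℓn - 2 * Real.log 2 + δ * Real.log 2 - Real.log 64 ≤ logι := by
    have h1 := Real.log_le_log (Real.rpow_pos_of_pos hn'pos _) hι₀
    rw [Real.log_rpow hn'pos, Real.log_mul (by norm_num) hι₀posR.ne'] at h1
    have h2 : ℓn - Real.log 2 ≤ Real.log n' := by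
      rw [hℓn, ← Real.log_div hnpos.ne' two_ne_zero]
      refine Real.log_le_log (by positivity) ?_
      rw [div_le_iff₀ two_pos]
      exact_mod_cast (show n ≤ n' * 2 by omega)
    have h3 : (2 - δ) * (ℓn - Real.log 2) ≤ (2 - δ) * Real.log n' :=
      mul_le_mul_of_nonneg_left h2 (by linarith)
    linarith
  /- ### the cyclic decomposition and the modulus `N` -/
  obtain ⟨k, m, hm2, ⟨e⟩, hprod, kL, r, hk, hLk, hhomo⟩ := exists_pi_zmod_decomp H L
  have hprodpos : 0 < ∏ j, m j := Finset.prod_pos fun j _ => by have := hm2 j; omega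
  set N : ℕ := (3 ^ k * ∏ j, m j) ^ 3 with hN
  have hNpos : 0 < N := pow_pos (Nat.mul_pos (pow_pos (by norm_num) k) hprodpos) 3
  haveI : NeZero N := ⟨hNpos.ne'⟩
  refine ⟨N, inferInstance, ?_, ?_⟩
  · -- `N₀ ≤ N`
    have h1 : (n : ℝ) ≤ Y := by
      rw [hY]
      conv_lhs => rw [← Real.rpow_one (n : ℝ)]
      exact Real.rpow_le_rpow_of_exponent_le hn1.le (by linarith)
    have h2 : n ≤ Fintype.card H := by exact_mod_cast (h1.trans hHge)
    have h3 : Fintype.card H ≤ N := by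
      rw [hN, ← hprod]
      calc ∏ j, m j ≤ 3 ^ k * ∏ j, m j := Nat.le_mul_of_pos_left _ (pow_pos (by norm_num) k)
        _ ≤ (3 ^ k * ∏ j, m j) ^ 3 := Nat.le_self_pow (by norm_num) _
    omega
  /- ### the lower bound for `Val(ℤ_N)` -/
  have hVal := sum_card_mul_le_prattVal_zmod_of_addEquiv hS (fun j => by have := hm2 j; omega)
    e (le_refl N)
  have hValR : (Fintype.card ι₀ : ℝ) * Y ^ 3 ≤ prattVal (ZMod N) :=
    (card_mul_pow_le_sum_sdpp i₁ i₂ i₃ hYpos.le hAB').trans (by exact_mod_cast hVal)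
  have hVpos : (0 : ℝ) < prattVal (ZMod N) := lt_of_lt_of_le (by positivity) hValR
  have hlogV : logι + 3 * (2 * ℓn - δ * ℓn) ≤ Real.log (prattVal (ZMod N)) := by
    have h := Real.log_le_log (mul_pos hι₀posR (pow_pos hYpos 3)) hValR
    rwa [Real.log_mul hι₀posR.ne' (pow_pos hYpos 3).ne', Real.log_pow, hlogY] at h
  /- ### the slice-rank bound on each homocyclic component: `3 Λ r_q ≤ 9 δ log n + c₀` -/
  set Z : ℝ := 4 * Fintype.card H / n with hZdef
  have hZpos : 0 < Z := by positivity
  have hlogZ : Real.log Z = Real.log 4 + logH - ℓn := by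
    rw [hZdef, Real.log_div (by positivity) hnpos.ne', Real.log_mul (by norm_num) hHpos.ne']
  have hZ : ∀ x, (#(A (i₁ x)) : ℝ) ≤ Z ∧ (#(B (i₁ x)) : ℝ) ≤ Z ∧ (#(A (i₂ x)) : ℝ) ≤ Z ∧
      (#(B (i₂ x)) : ℝ) ≤ Z ∧ (#(A (i₃ x)) : ℝ) ≤ Z ∧ (#(B (i₃ x)) : ℝ) ≤ Z := by
    have key : ∀ i ∈ good, (#(A i) : ℝ) ≤ Z ∧ (#(B i) : ℝ) ≤ Z := by
      intro i hi
      obtain ⟨ha, hb⟩ := hgood i hi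
      rw [hZdef, le_div_iff₀ hnpos, le_div_iff₀ hnpos]
      exact ⟨by exact_mod_cast ha, by exact_mod_cast hb⟩
    intro x
    exact ⟨(key _ (hgmem _)).1, (key _ (hgmem _)).2, (key _ (hgmem _)).1, (key _ (hgmem _)).2,
      (key _ (hgmem _)).1, (key _ (hgmem _)).2⟩
  have hSdiv := card_mul_pow_div_le_sum_div_sdpp i₁ i₂ i₃ hYpos hAB' hZ
  push_cast at hSdiv
  have hlhs_pos : 0 < (Fintype.card ι₀ : ℝ) * Y ^ 3 / (3 * Z ^ 2) :=
    div_pos (mul_pos hι₀posR (pow_pos hYpos 3)) (by positivity)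
  have hloglhs : Real.log ((Fintype.card ι₀ : ℝ) * Y ^ 3 / (3 * Z ^ 2)) =
      logι + 3 * (2 * ℓn - δ * ℓn) - (Real.log 3 + 2 * (Real.log 4 + logH - ℓn)) := by
    rw [Real.log_div (mul_pos hι₀posR (pow_pos hYpos 3)).ne' (by positivity),
      Real.log_mul hι₀posR.ne' (pow_pos hYpos 3).ne', Real.log_pow, hlogY,
      Real.log_mul (by norm_num) (pow_pos hZpos 2).ne', Real.log_pow, hlogZ]
    push_cast
    ring
  have hr : ∀ q ∈ Icc 2 L, 3 * Λ * r q ≤ 9 * (δ * ℓn) + c₀ := by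
    intro q hq
    rcases Nat.eq_zero_or_pos (r q) with h0 | hrpos
    · rw [h0, Nat.cast_zero, mul_zero]
      positivity
    obtain ⟨p, hp, s, hqps, κ, _, _, G', _, _, _, hκ, ⟨e'⟩⟩ := hhomo q hq hrpos.ne'
    haveI : Fact p.Prime := ⟨hp⟩
    have hq2 : 2 ≤ q := (mem_Icc.1 hq).1
    haveI : NeZero q := ⟨by omega⟩
    obtain ⟨e3⟩ := nonempty_addEquiv_triple e'
    have hb := sum_card_div_le_of_addEquiv_piZMod hS (p := p) s hqps e3 (hθpos q) (hθ q hq2).2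
    have hmain := hSdiv.trans hb
    rw [Fintype.card_sum, Fintype.card_sum, hκ, Fintype.card_prod, Fintype.card_prod] at hmain
    have hθq1 : θ q < 1 := (hθ q hq2).1
    have hrhs : Real.log (θ q ^ (r q + (r q + r q)) *
        ((Fintype.card H * (Fintype.card H * Fintype.card H) : ℕ) : ℝ)) =
        3 * r q * Real.log (θ q) + 3 * logH := by
      have hH3 : ((Fintype.card H * (Fintype.card H * Fintype.card H) : ℕ) : ℝ) ≠ 0 := by
        exact_mod_cast (Nat.mul_pos Fintype.card_pos
          (Nat.mul_pos Fintype.card_pos Fintype.card_pos)).ne'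
      rw [Real.log_mul (pow_pos (hθpos q) _).ne' hH3, Real.log_pow]
      push_cast
      rw [Real.log_mul hHpos.ne' (mul_pos hHpos hHpos).ne', Real.log_mul hHpos.ne' hHpos.ne']
      ring
    have h1 := Real.log_le_log hlhs_pos hmain
    rw [hloglhs, hrhs] at h1
    have h2 : (r q : ℝ) * Λ ≤ (r q) * (-Real.log (θ q)) :=
      mul_le_mul_of_nonneg_left (hΛle q hq) (Nat.cast_nonneg _)
    rw [hc₀]
    linarith [h1, h2, hlogH_le, hlogι, hδℓ, hlog2, mul_nonneg hδpos.le hlog2]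
  /- ### counting the cyclic factors -/
  have hsumr : 3 * Λ * ((∑ q ∈ Icc 2 L, r q : ℕ) : ℝ) ≤ L * (9 * (δ * ℓn) + c₀) := by
    push_cast
    rw [Finset.mul_sum]
    calc ∑ q ∈ Icc 2 L, 3 * Λ * (r q : ℝ) ≤ ∑ _q ∈ Icc 2 L, (9 * (δ * ℓn) + c₀) :=
          sum_le_sum hr
      _ = (#(Icc 2 L) : ℝ) * (9 * (δ * ℓn) + c₀) := by rw [sum_const, nsmul_eq_mul]
      _ ≤ L * (9 * (δ * ℓn) + c₀) := by
          refine mul_le_mul_of_nonneg_right ?_ (by positivity)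
          have : #(Icc 2 L) ≤ L := by rw [Nat.card_Icc]; omega
          exact_mod_cast this
  have hkL : (kL : ℝ) * Real.log L ≤ logH := by
    have h1 : ((L ^ kL : ℕ) : ℝ) ≤ Fintype.card H := by exact_mod_cast hLk
    have h2 := Real.log_le_log (by exact_mod_cast pow_pos (show 0 < L by omega) kL) h1
    rwa [Nat.cast_pow, Real.log_pow] at h2
  have hNR : (N : ℝ) = ((3 : ℝ) ^ k * Fintype.card H) ^ 3 := by
    rw [hN, ← hprod]
    push_cast
    ring
  have hlogN : Real.log (N : ℝ) = 3 * (k * c3 + logH) := by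
    rw [hNR, Real.log_pow, Real.log_mul (pow_pos (by norm_num) k).ne' hHpos.ne', Real.log_pow]
    push_cast
    ring
  have hkR : (k : ℝ) = kL + ((∑ q ∈ Icc 2 L, r q : ℕ) : ℝ) := by exact_mod_cast hk
  -- `3 c3 kL ≤ (3/4) ε log n`
  have hkL' : 3 * c3 * kL ≤ 3 / 4 * (ε * ℓn) := by
    have h12 : 12 * c3 ≤ ε * Real.log L := by
      have := (div_le_iff₀ hε).1 hlogL
      linarith
    have hkL0 : (0 : ℝ) ≤ kL := Nat.cast_nonneg _
    have h1 : 12 * c3 * kL ≤ ε * Real.log L * kL := mul_le_mul_of_nonneg_right h12 hkL0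
    have h2 : ε * Real.log L * kL ≤ ε * (3 * ℓn) := by
      rw [mul_assoc]
      refine mul_le_mul_of_nonneg_left ?_ hε.le
      calc Real.log L * kL = kL * Real.log L := mul_comm _ _
        _ ≤ logH := hkL
        _ ≤ 2 * ℓn + δ * ℓn := hlogH_le
        _ ≤ 3 * ℓn := by linarith
    linarith
  -- `3 c3 Σ r ≤ (3/4) M δ log n + L c3 c₀ / Λ`
  have hsumr' : 3 * c3 * ((∑ q ∈ Icc 2 L, r q : ℕ) : ℝ) ≤
      3 / 4 * (M * (δ * ℓn)) + L * c3 * c₀ / Λ := by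
    have h1 := mul_le_mul_of_nonneg_left hsumr (div_nonneg hc3pos.le hΛpos.le)
    have e1 : c3 / Λ * (3 * Λ * ((∑ q ∈ Icc 2 L, r q : ℕ) : ℝ)) =
        3 * c3 * ((∑ q ∈ Icc 2 L, r q : ℕ) : ℝ) := by field_simp
    have e2 : c3 / Λ * (L * (9 * (δ * ℓn) + c₀)) = 3 / 4 * (M * (δ * ℓn)) + L * c3 * c₀ / Λ := by
      rw [hM]; field_simp; ring
    rwa [e1, e2] at h1
  have hMδ : M * (δ * ℓn) = ε * ℓn - 8 * (δ * ℓn) := by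
    have : M * δ = ε - 8 * δ := by linarith [hδM]   -- from δ (M+8) = ε
    calc M * (δ * ℓn) = (M * δ) * ℓn := by ring
      _ = (ε - 8 * δ) * ℓn := by rw [this]
      _ = ε * ℓn - 8 * (δ * ℓn) := by ring
  have hCdef : L * c3 * c₀ / Λ = 3 / 4 * (C - 2 * Real.log 2 - Real.log 64) := by
    rw [hC]; ring
  /- ### conclusion -/
  rw [Real.rpow_def_of_pos (by exact_mod_cast hNpos), ← Real.exp_log hVpos, Real.exp_le_exp,
    hlogN]
  have hεlogH : ε * (2 * ℓn - δ * ℓn) ≤ ε * logH := mul_le_mul_of_nonneg_left hlogH_ge hε.le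
  have hk0 : (0 : ℝ) ≤ ε * (k * c3) := by positivity
  have hεδ : ε * (δ * ℓn) ≤ ε * ℓn := mul_le_mul_of_nonneg_left hδℓ hε.le
  have hδlog2 : 0 ≤ δ * Real.log 2 := mul_nonneg hδpos.le hlog2
  have hkc3 : (k : ℝ) * c3 = kL * c3 + ((∑ q ∈ Icc 2 L, r q : ℕ) : ℝ) * c3 := by rw [hkR]; ring
  linarith [hlogV, hlogι, hkc3, hkL', hsumr', hMδ, hCdef, hCn, hεlogH, hk0, hεδ, hδlog2,
    hlogH_le]

/-- **Pratt 2024, Theorem 4.7** — the named fact `pratt2024_thm47` DISCHARGED: if the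
two-families conjecture (CKSU 2005, Conj. 4.7 = Pratt Conj. 2.5, inlined) holds, then for every
`ε > 0` there are arbitrarily large `N` with `N^{4/3-ε} ≤ Val(ℤ/Nℤ)`.  Proof: the printed one
(arXiv p. 10) — see `pratt2024_thm47_aux` and the sibling files `PrattTrapezoidValSTPP`
(Prop. 3.3 + mixed-radix transfer), `PrattTrapezoidValSDPP` (CKSU construction + Behrend),
`PrattTrapezoidValSliceRank` (the [BCCGNSU 2017] input), `PrattTrapezoidValDecomp`
(bookkeeping). [cite: Pratt2024, Thm. 4.7] -/
theorem pratt2024_thm47_holds : pratt2024_thm47 := by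
  intro hTF ε hε N₀
  obtain ⟨N, _, hN₀, hN⟩ := pratt2024_thm47_aux hTF (min ε 1) (lt_min hε one_pos)
    (min_le_right _ _) N₀
  refine ⟨N, ‹_›, hN₀, le_trans ?_ hN⟩
  have hN1 : (1 : ℝ) ≤ N := by exact_mod_cast Nat.one_le_iff_ne_zero.2 (NeZero.ne N)
  exact Real.rpow_le_rpow_of_exponent_le hN1 (by linarith [min_le_left ε 1])

end Thm47

end Literature.Computability.AlgebraicComplexity
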